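/-
Copyright: H21 programme, solo seat `solo-RiemannHypothesis-informed` (session 6).
-/
import Summits.RiemannHypothesis.RiemannHypothesis.Theorems.SoloInformedCombBump

/-!
# Poisson flatness of the comb transform and the comb-weight majorant (solo-informed, T39c)

Continuation of `SoloInformedCombBump`.  Two facts about `Φ_J(μ) = ∑_{|n| ≤ J} X(μ + iπn)`
(`X(μ) = ∫ χ(u) e^{μu} du`, `χ = b₁`, `supp χ ⊆ [-1,1]`, `χ(0) = 1`) in the strip `|Re μ| ≤ 1/2`:

* **Poisson** (`hasSum_chiXform`): `∑_{n ∈ ℤ} X(μ - iπn) = 2` for EVERY `μ ∈ ℂ` — Poisson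
  summation (Mathlib's `Real.tsum_eq_tsum_fourier_of_rpow_decay`, through the tree toolkit of
  `Literature.NumberTheory.Sieve.FriedlanderIwaniecPrimes`) for `F(v) = χ(2v) e^{2μv}`, whose
  samples `F(n)`, `n ∈ ℤ`, vanish except `F(0) = 1`, and `𝓕F(n) = X(μ - iπn)/2`.
* **Flatness on the core** (`norm_combXform_sub_two_le`): for `2 ≤ q`, `1 ≤ K ≤ J`,
  `|Re μ| ≤ 1/2`, `|Im μ| ≤ π(J - K)`:  `‖Φ_J(μ) - 2‖ ≤ 2 L_q / (π^q K^{q-1})`,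
  the missing teeth `|n| > J` being at distance `≥ π(K + i)` from `Im μ` and `‖X‖ ≤ L_q/|Im|^q`.
* The comb-weight majorants are in `SoloInformedCombWeight`.
-/

noncomputable section

open Real MeasureTheory Filter Complex Set Literature.NumberTheory.LFunctions
  Literature.NumberTheory.Sieve.FriedlanderIwaniecPrimes
open scoped FourierTransform Topology ContDiff ComplexConjugate

namespace Summit.RiemannHypothesis.RiemannHypothesis.Theorems

open Companion

/-! ## Fourier identification and Poisson summation -/

/-- `𝓕(χ e^{μ·})(ξ) = X(μ - 2πiξ)`. -/
theorem fourier_combChi_mul_cexp (μ : ℂ) (ξ : ℝ) :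
    𝓕 (fun u : ℝ ↦ combChi u * cexp (μ * u)) ξ = chiXform (μ - 2 * π * ξ * I) := by
  rw [Real.fourier_real_eq_integral_exp_smul]
  unfold chiXform
  refine integral_congr_ae (Eventually.of_forall fun v ↦ ?_)
  simp only [smul_eq_mul]
  have h : (μ - 2 * π * ξ * I) * v = μ * v + ((-2 * π * v * ξ : ℝ) : ℂ) * I := by
    push_cast; ring
  rw [h, Complex.exp_add]
  ring

/-- **Poisson flatness.** `∑_{n ∈ ℤ} X(μ - iπn) = 2` for every `μ ∈ ℂ`. -/
theorem hasSum_chiXform (μ : ℂ) : HasSum (fun n : ℤ ↦ chiXform (μ - π * n * I)) 2 := by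
  set G : ℝ → ℂ := fun u ↦ combChi u * cexp (μ * u) with hG
  have hGd : ContDiff ℝ ∞ G :=
    contDiff_combChi.mul (contDiff_const.mul Complex.ofRealCLM.contDiff).cexp
  have hGc : HasCompactSupport G := hasCompactSupport_combChi.mul_right
  set F : ℝ → ℂ := fun v ↦ G (0 + 2 * v) with hF
  have hFd : ContDiff ℝ ∞ F := hGd.comp (contDiff_const.add (contDiff_const.mul contDiff_id))
  have hFc : HasCompactSupport F := by
    have h := hGc.comp_homeomorph ((Homeomorph.mulLeft₀ (2 : ℝ) two_ne_zero).trans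
      (Homeomorph.addLeft (0 : ℝ)))
    have hFeq : F = G ∘ ⇑((Homeomorph.mulLeft₀ (2 : ℝ) two_ne_zero).trans
        (Homeomorph.addLeft (0 : ℝ))) := by
      funext u; rfl
    rw [hFeq]; exact h
  -- Poisson summation for `F` at `x = 0`
  have hP := Real.tsum_eq_tsum_fourier_of_rpow_decay hFd.continuous one_lt_two
    (isBigO_cocompact_of_hasCompactSupport hFc _) (fourier_isBigO_rpow_neg_two hFd hFc) 0
  simp only [zero_add, QuotientAddGroup.mk_zero, fourier_eval_zero, mul_one] at hP
  -- the left side is `F 0 = 1`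
  have hF0 : ∀ n : ℤ, n ≠ 0 → F n = 0 := by
    intro n hn
    have h1 : (1 : ℝ) ≤ |(2 * n : ℝ)| := by
      rw [abs_mul, abs_two]
      have : (1 : ℝ) ≤ |(n : ℝ)| := by
        rw [← Int.cast_abs]; exact_mod_cast Int.one_le_abs hn
      linarith
    simp [hF, hG, combChi_eq_zero h1]
  have hL : ∑' n : ℤ, F n = 1 := by
    rw [tsum_eq_single 0 hF0]
    simp [hF, hG, combChi_zero]
  -- the Fourier side
  have hFT : ∀ ξ : ℝ, 𝓕 F ξ = (1 / 2 : ℂ) * chiXform (μ - π * ξ * I) := by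
    intro ξ
    rw [hF, fourier_comp_affine G two_pos 0 ξ, hG, fourier_combChi_mul_cexp]
    have : μ - 2 * π * ((ξ / 2 : ℝ) : ℂ) * I = μ - π * ξ * I := by push_cast; ring
    rw [this]
    simp
  have hS : Summable fun n : ℤ ↦ 𝓕 F n := by
    simpa using summable_fourier_div hFd hFc one_pos
  have hsum1 : HasSum (fun n : ℤ ↦ 𝓕 F n) 1 := by
    rw [← hL, hP]; exact hS.hasSum
  have h2 := hsum1.mul_left 2
  have hfun : (fun n : ℤ ↦ chiXform (μ - π * n * I)) = fun n : ℤ ↦ 2 * 𝓕 F n := by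
    funext n; rw [hFT]; push_cast; ring
  rw [hfun]
  have h3 : (2 : ℂ) * 1 = 2 := mul_one 2
  rw [h3] at h2
  exact h2

/-! ## Flatness on the core -/

/-- Off-tooth decay: `‖X(μ + it)‖ ≤ L_q / d^q` when `|Im μ + t| ≥ d > 0`, `|Re μ| ≤ 1/2`. -/
theorem norm_chiXform_shift_le_div (q : ℕ) {μ : ℂ} (hre : |μ.re| ≤ 1 / 2) (t : ℝ) {d : ℝ}
    (hd : 0 < d) (hdist : d ≤ |μ.im + t|) :
    ‖chiXform (μ + t * I)‖ ≤ combL q / d ^ q := by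
  have hre' : |(μ + t * I).re| ≤ 1 / 2 := by simpa using hre
  have him' : (μ + t * I).im = μ.im + t := by simp
  have hne : (μ + t * I).im ≠ 0 := by
    rw [him']; intro h; rw [h, abs_zero] at hdist; linarith
  refine (norm_chiXform_le_div q hre' hne).trans ?_
  rw [him']
  exact div_le_div_of_nonneg_left (combL_nonneg q) (pow_pos hd q)
    (pow_le_pow_left₀ hd.le hdist q)

/-- The shifted `q`-series: `∑_{i<N} (K+1+i)^{-q} ≤ K^{1-q}` (`q ≥ 2`, `K ≥ 1`), by telescoping. -/
theorem sum_inv_pow_shift_le {q K : ℕ} (hq : 2 ≤ q) (hK : 1 ≤ K) (N : ℕ) :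
    ∑ i ∈ Finset.range N, (((K : ℝ) + 1 + i) ^ q)⁻¹ ≤ ((K : ℝ) ^ (q - 1))⁻¹ := by
  have hKr : (1 : ℝ) ≤ K := by exact_mod_cast hK
  have hK0 : (0 : ℝ) < K := by linarith
  set a : ℕ → ℝ := fun i ↦ ((K : ℝ) + i)⁻¹ with ha
  have hterm : ∀ i : ℕ, (((K : ℝ) + 1 + i) ^ q)⁻¹ ≤ ((K : ℝ) ^ (q - 2))⁻¹ * (a i - a (i + 1)) := by
    intro i
    have hi : (0 : ℝ) ≤ i := Nat.cast_nonneg i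
    have hKi : 0 < (K : ℝ) + i := by linarith
    have hKi1 : 0 < (K : ℝ) + 1 + i := by linarith
    have hai : a i - a (i + 1) = (((K : ℝ) + i) * ((K : ℝ) + 1 + i))⁻¹ := by
      simp only [ha]; push_cast
      field_simp
      ring
    rw [hai, ← mul_inv]
    rw [inv_le_inv₀ (by positivity) (by positivity)]
    obtain ⟨r, hr⟩ : ∃ r, q = r + 2 := ⟨q - 2, by omega⟩
    subst hr
    rw [Nat.add_sub_cancel, pow_add]
    have h1 : (K : ℝ) ^ r ≤ ((K : ℝ) + 1 + i) ^ r :=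
      pow_le_pow_left₀ hK0.le (by linarith) r
    have h2 : ((K : ℝ) + i) * (K + 1 + i) ≤ ((K : ℝ) + 1 + i) ^ 2 := by nlinarith
    calc (K : ℝ) ^ r * ((K + i) * (K + 1 + i)) ≤ ((K : ℝ) + 1 + i) ^ r * ((K : ℝ) + 1 + i) ^ 2 :=
          mul_le_mul h1 h2 (by positivity) (by positivity)
      _ = ((K : ℝ) + 1 + i) ^ r * ((K : ℝ) + 1 + i) ^ 2 := rfl
  have htel : ∑ i ∈ Finset.range N, (a i - a (i + 1)) = a 0 - a N := Finset.sum_range_sub' a N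
  calc ∑ i ∈ Finset.range N, (((K : ℝ) + 1 + i) ^ q)⁻¹
      ≤ ∑ i ∈ Finset.range N, ((K : ℝ) ^ (q - 2))⁻¹ * (a i - a (i + 1)) := Finset.sum_le_sum fun i _ ↦ hterm i
    _ = ((K : ℝ) ^ (q - 2))⁻¹ * (a 0 - a N) := by rw [← Finset.mul_sum, htel]
    _ ≤ ((K : ℝ) ^ (q - 2))⁻¹ * a 0 := by
        have hN : 0 ≤ a N := by simp only [ha]; positivity
        have h0 : 0 ≤ ((K : ℝ) ^ (q - 2))⁻¹ := by positivity
        nlinarith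
    _ = ((K : ℝ) ^ (q - 1))⁻¹ := by
        simp only [ha, Nat.cast_zero, add_zero]
        rw [← mul_inv]
        congr 1
        obtain ⟨r, hr⟩ : ∃ r, q = r + 2 := ⟨q - 2, by omega⟩
        subst hr
        rw [Nat.add_sub_cancel, show r + 2 - 1 = r + 1 by omega, pow_succ]

/-- **Flatness on the core (T39c).**  For `2 ≤ q`, `1 ≤ K ≤ J`, `|Re μ| ≤ 1/2` and
`|Im μ| ≤ π(J - K)`:  `‖Φ_J(μ) - 2‖ ≤ 2 L_q / (π^q K^{q-1})`. -/
theorem norm_combXform_sub_two_le {q J K : ℕ} (hq : 2 ≤ q) (hK : 1 ≤ K) (hKJ : K ≤ J) {μ : ℂ}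
    (hre : |μ.re| ≤ 1 / 2) (him : |μ.im| ≤ π * (J - K)) :
    ‖combXform J μ - 2‖ ≤ 2 * combL q / (π ^ q * K ^ (q - 1)) := by
  obtain ⟨f, hf_def, hf⟩ : ∃ f : ℤ → ℂ, (∀ n : ℤ, f n = chiXform (μ - π * n * I)) ∧ HasSum f 2 :=
    ⟨_, fun n ↦ rfl, hasSum_chiXform μ⟩
  have hg : HasSum (fun m : ℕ ↦ f m + f (-m)) (2 + f 0) := hf.nat_add_neg
  have htend := hg.tendsto_sum_nat
  set S : ℂ := ∑ m ∈ Finset.range (J + 1), (f m + f (-m)) with hS_def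
  -- identification of the `(J+1)`-st partial sum
  have hS : S = f 0 + combXform J μ := by
    rw [hS_def, Finset.sum_range_succ', combXform_eq]
    have f0 : f 0 = chiXform μ := by rw [hf_def]; simp
    have f00 : f ((0 : ℕ) : ℤ) + f (-((0 : ℕ) : ℤ)) = f 0 + f 0 := by simp
    have gi : ∀ i : ℕ, f ((i + 1 : ℕ) : ℤ) + f (-((i + 1 : ℕ) : ℤ)) =
        chiXform (μ + tooth i * I) + chiXform (μ - tooth i * I) := by
      intro i
      rw [hf_def, hf_def, add_comm]
      congr 2
      · unfold tooth; push_cast; ring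
      · unfold tooth; push_cast; ring
    rw [f00, Finset.sum_congr rfl fun i _ ↦ gi i, f0]
    ring
  -- uniform tail bound
  set B : ℝ := 2 * combL q / (π ^ q * K ^ (q - 1)) with hB
  have hJK : (0 : ℝ) ≤ (J : ℝ) - K := by
    have : (K : ℝ) ≤ J := by exact_mod_cast hKJ
    linarith
  have htail : ∀ N : ℕ,
      ‖∑ m ∈ Finset.range (J + 1 + N), (f m + f (-m)) - S‖ ≤ B := by
    intro N
    rw [Finset.sum_range_add, hS_def, add_sub_cancel_left]
    have hterm : ∀ i : ℕ, ‖f ((J + 1 + i : ℕ) : ℤ) + f (-((J + 1 + i : ℕ) : ℤ))‖ ≤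
        2 * combL q * (π ^ q)⁻¹ * (((K : ℝ) + 1 + i) ^ q)⁻¹ := by
      intro i
      have hd : 0 < π * ((K : ℝ) + 1 + i) := by positivity
      have hdist : ∀ σ : ℝ, σ = 1 ∨ σ = -1 →
          π * ((K : ℝ) + 1 + i) ≤ |μ.im + σ * (-(π * ((J : ℝ) + 1 + i)))| := by
        intro σ hσ
        have hμ := abs_le.mp him
        rcases hσ with h | h
        · rw [h, one_mul, abs_of_nonpos (by nlinarith [Real.pi_pos])]
          nlinarith [Real.pi_pos]
        · rw [h, neg_one_mul, neg_neg, abs_of_nonneg (by nlinarith [Real.pi_pos])]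
          nlinarith [Real.pi_pos]
      have e1 : f ((J + 1 + i : ℕ) : ℤ) = chiXform (μ + ((1 : ℝ) * (-(π * ((J : ℝ) + 1 + i))) : ℝ) * I) := by
        rw [hf_def]; congr 1; push_cast; ring
      have e2 : f (-((J + 1 + i : ℕ) : ℤ)) = chiXform (μ + ((-1 : ℝ) * (-(π * ((J : ℝ) + 1 + i))) : ℝ) * I) := by
        rw [hf_def]; congr 1; push_cast; ring
      have b1 := norm_chiXform_shift_le_div q hre _ hd (hdist 1 (Or.inl rfl))
      have b2 := norm_chiXform_shift_le_div q hre _ hd (hdist (-1) (Or.inr rfl))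
      rw [← e1] at b1
      rw [← e2] at b2
      have hsplit : combL q / (π * ((K : ℝ) + 1 + i)) ^ q =
          combL q * (π ^ q)⁻¹ * (((K : ℝ) + 1 + i) ^ q)⁻¹ := by
        rw [mul_pow, div_eq_mul_inv, mul_inv, mul_assoc]
      calc ‖f ((J + 1 + i : ℕ) : ℤ) + f (-((J + 1 + i : ℕ) : ℤ))‖
          ≤ ‖f ((J + 1 + i : ℕ) : ℤ)‖ + ‖f (-((J + 1 + i : ℕ) : ℤ))‖ := norm_add_le _ _
        _ ≤ combL q / (π * ((K : ℝ) + 1 + i)) ^ q + combL q / (π * ((K : ℝ) + 1 + i)) ^ q :=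
            add_le_add b1 b2
        _ = 2 * combL q * (π ^ q)⁻¹ * (((K : ℝ) + 1 + i) ^ q)⁻¹ := by rw [hsplit]; ring
    calc ‖∑ i ∈ Finset.range N, (f ((J + 1 + i : ℕ) : ℤ) + f (-((J + 1 + i : ℕ) : ℤ)))‖
        ≤ ∑ i ∈ Finset.range N, ‖f ((J + 1 + i : ℕ) : ℤ) + f (-((J + 1 + i : ℕ) : ℤ))‖ :=
          norm_sum_le _ _
      _ ≤ ∑ i ∈ Finset.range N, 2 * combL q * (π ^ q)⁻¹ * (((K : ℝ) + 1 + i) ^ q)⁻¹ :=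
          Finset.sum_le_sum fun i _ ↦ hterm i
      _ = 2 * combL q * (π ^ q)⁻¹ * ∑ i ∈ Finset.range N, (((K : ℝ) + 1 + i) ^ q)⁻¹ := by
          rw [Finset.mul_sum]
      _ ≤ 2 * combL q * (π ^ q)⁻¹ * ((K : ℝ) ^ (q - 1))⁻¹ :=
          mul_le_mul_of_nonneg_left (sum_inv_pow_shift_le hq hK N)
            (by have := combL_nonneg q; positivity)
      _ = B := by rw [hB, div_eq_mul_inv, mul_inv]; ring
  -- pass to the limit
  have hev : ∀ᶠ N : ℕ in atTop, ‖∑ m ∈ Finset.range N, (f m + f (-m)) - S‖ ≤ B := by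
    refine Filter.eventually_atTop.mpr ⟨J + 1, fun N hN ↦ ?_⟩
    obtain ⟨i, rfl⟩ := Nat.exists_eq_add_of_le hN
    exact htail i
  have hlim : Tendsto (fun N : ℕ ↦ ‖∑ m ∈ Finset.range N, (f m + f (-m)) - S‖) atTop
      (𝓝 ‖(2 + f 0) - S‖) := (htend.sub_const S).norm
  have hle : ‖(2 + f 0) - S‖ ≤ B := le_of_tendsto hlim hev
  have heq : combXform J μ - 2 = -((2 + f 0) - S) := by rw [hS]; ring
  rw [heq, norm_neg]
  exact hle

end Summit.RiemannHypothesis.RiemannHypothesis.Theorems
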